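import Summits.Ventures.HodgeRepro.Night1Faces6Cyclic
import Summits.Ventures.HodgeRepro.Night1Faces8Cyclic
import Summits.Ventures.HodgeRepro.Night1Faces8C4C2Square
import Summits.Ventures.HodgeRepro.Night1Faces8C4C2Nonsquare
import Summits.Ventures.HodgeRepro.Night1Faces8Triquadratic
import Summits.Ventures.HodgeRepro.Night1Faces8Dihedral
import Summits.Ventures.HodgeRepro.Night1Faces8Quaternion
import Summits.Ventures.HodgeRepro.Night1ProductWeilExceptional

/-!
# The sealed degree-6 and degree-8 faces are exceptional on the kernel: for each of the 1 + 25 rank-four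
faces of the sealed census the Weil space of the four-corner product meets the products of two divisor
classes only in `0`

Blind re-derivation cell `pub-hodge-repro`, seat `night-1` (gen 5, fourth file).  Imports gen 0's face
records `Night1Faces6Cyclic` / `Night1Faces8{Cyclic, C4C2Square, C4C2Nonsquare, Triquadratic, Dihedral,
Quaternion}` (the sealed representatives as `FaceData` records with their decided checks `face<n>_ok`) and
`Night1ProductWeilExceptional` (`face_weilSpaceProd_inf_divisorPowerIn_eq_bot`: the Weil classes of a
rank-four face of a CM type are exceptional when `|G| > 4`).

* `FaceData.exceptional` — the generic form on a face record: `D.Ok c` (the decided checks: `Φ` a CM type,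
  the places distinct, …) and `|G| > 4` give `W ⊓ D² = 0` on the full four-corner product `Fin 4 × G`;
* `Faces6Cyclic.face0_exceptional` and the 25 `Faces8<Group>.face<n>_exceptional` — one line each: the
  sealed degree-6 and degree-8 faces (ROUTE.md §3.3's table; `|G| = 6, 8 > 4`).

So every face of the sealed census in degrees 6 and 8 — the open frontier of S4 in these degrees — carries
Weil classes that no polynomial in divisor classes reaches (on the kernel; with `H¹(B, ℚ) = K^ι` and
typer-2's dictionary, paper-level, NIGHT1.md §12).  Nothing geometric is built; nothing here says anything
about the status of the Hodge conjecture for CM abelian varieties, which is NOT proved.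
-/

set_option autoImplicit false

open Finset
open scoped Pointwise

namespace HodgeRepro.RouteC

open CMHodgeOn

/-- **The generic form on a face record**: a face record passing its decided checks (`D.Ok c`) in a group of
order `> 4` has exceptional Weil classes — the Weil space of its four-corner product meets the products of
two divisor classes only in `0`. -/
theorem FaceData.exceptional {G : Type*} [Group G] [DecidableEq G] [Fintype G] {c : G}
    (hc : IsComplexConj c) (D : FaceData G) (hok : D.Ok c) (h4 : 4 < Fintype.card G) :
    weilSpaceProd G 2 (Equiv.refl (Fin (2 * 2))) ⊓
      divisorPowerIn (fun g : G => prodTypeSet fun i => g • D.face c i) 2 = ⊥ :=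
  face_weilSpaceProd_inf_divisorPowerIn_eq_bot hc hok.1 hok.2.2.1 h4


/-! ### Degree 6: cyclic sextic — 1 sealed face -/

namespace Faces6Cyclic

/-- Faces6Cyclic: the sealed face `face0` is exceptional. -/
theorem face0_exceptional :
    weilSpaceProd C6 2 (Equiv.refl (Fin (2 * 2))) ⊓
      divisorPowerIn (fun g : C6 => prodTypeSet fun i => g • (face0).face cc_C6 i) 2 = ⊥ :=
  (face0).exceptional cc_C6_isComplexConj face0_ok (by decide)

end Faces6Cyclic


/-! ### Degree 8: cyclic octic — 3 sealed faces -/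

namespace Faces8Cyclic

/-- Faces8Cyclic: the sealed face `face0` is exceptional. -/
theorem face0_exceptional :
    weilSpaceProd C8 2 (Equiv.refl (Fin (2 * 2))) ⊓
      divisorPowerIn (fun g : C8 => prodTypeSet fun i => g • (face0).face cc_C8 i) 2 = ⊥ :=
  (face0).exceptional cc_C8_isComplexConj face0_ok (by decide)

/-- Faces8Cyclic: the sealed face `face1` is exceptional. -/
theorem face1_exceptional :
    weilSpaceProd C8 2 (Equiv.refl (Fin (2 * 2))) ⊓
      divisorPowerIn (fun g : C8 => prodTypeSet fun i => g • (face1).face cc_C8 i) 2 = ⊥ :=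
  (face1).exceptional cc_C8_isComplexConj face1_ok (by decide)

/-- Faces8Cyclic: the sealed face `face2` is exceptional. -/
theorem face2_exceptional :
    weilSpaceProd C8 2 (Equiv.refl (Fin (2 * 2))) ⊓
      divisorPowerIn (fun g : C8 => prodTypeSet fun i => g • (face2).face cc_C8 i) 2 = ⊥ :=
  (face2).exceptional cc_C8_isComplexConj face2_ok (by decide)

end Faces8Cyclic


/-! ### Degree 8: `C₄ × C₂`, square conjugation — 4 sealed faces -/

namespace Faces8C4C2Square

/-- Faces8C4C2Square: the sealed face `face0` is exceptional. -/
theorem face0_exceptional :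
    weilSpaceProd C4xC2 2 (Equiv.refl (Fin (2 * 2))) ⊓
      divisorPowerIn (fun g : C4xC2 => prodTypeSet fun i => g • (face0).face cc_C4xC2_sq i) 2 = ⊥ :=
  (face0).exceptional cc_C4xC2_sq_isComplexConj face0_ok (by decide)

/-- Faces8C4C2Square: the sealed face `face1` is exceptional. -/
theorem face1_exceptional :
    weilSpaceProd C4xC2 2 (Equiv.refl (Fin (2 * 2))) ⊓
      divisorPowerIn (fun g : C4xC2 => prodTypeSet fun i => g • (face1).face cc_C4xC2_sq i) 2 = ⊥ :=
  (face1).exceptional cc_C4xC2_sq_isComplexConj face1_ok (by decide)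

/-- Faces8C4C2Square: the sealed face `face2` is exceptional. -/
theorem face2_exceptional :
    weilSpaceProd C4xC2 2 (Equiv.refl (Fin (2 * 2))) ⊓
      divisorPowerIn (fun g : C4xC2 => prodTypeSet fun i => g • (face2).face cc_C4xC2_sq i) 2 = ⊥ :=
  (face2).exceptional cc_C4xC2_sq_isComplexConj face2_ok (by decide)

/-- Faces8C4C2Square: the sealed face `face3` is exceptional. -/
theorem face3_exceptional :
    weilSpaceProd C4xC2 2 (Equiv.refl (Fin (2 * 2))) ⊓
      divisorPowerIn (fun g : C4xC2 => prodTypeSet fun i => g • (face3).face cc_C4xC2_sq i) 2 = ⊥ :=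
  (face3).exceptional cc_C4xC2_sq_isComplexConj face3_ok (by decide)

end Faces8C4C2Square


/-! ### Degree 8: `C₄ × C₂`, non-square conjugation — 4 sealed faces -/

namespace Faces8C4C2Nonsquare

/-- Faces8C4C2Nonsquare: the sealed face `face0` is exceptional. -/
theorem face0_exceptional :
    weilSpaceProd C4xC2 2 (Equiv.refl (Fin (2 * 2))) ⊓
      divisorPowerIn (fun g : C4xC2 => prodTypeSet fun i => g • (face0).face cc_C4xC2_ns i) 2 = ⊥ :=
  (face0).exceptional cc_C4xC2_ns_isComplexConj face0_ok (by decide)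

/-- Faces8C4C2Nonsquare: the sealed face `face1` is exceptional. -/
theorem face1_exceptional :
    weilSpaceProd C4xC2 2 (Equiv.refl (Fin (2 * 2))) ⊓
      divisorPowerIn (fun g : C4xC2 => prodTypeSet fun i => g • (face1).face cc_C4xC2_ns i) 2 = ⊥ :=
  (face1).exceptional cc_C4xC2_ns_isComplexConj face1_ok (by decide)

/-- Faces8C4C2Nonsquare: the sealed face `face2` is exceptional. -/
theorem face2_exceptional :
    weilSpaceProd C4xC2 2 (Equiv.refl (Fin (2 * 2))) ⊓
      divisorPowerIn (fun g : C4xC2 => prodTypeSet fun i => g • (face2).face cc_C4xC2_ns i) 2 = ⊥ :=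
  (face2).exceptional cc_C4xC2_ns_isComplexConj face2_ok (by decide)

/-- Faces8C4C2Nonsquare: the sealed face `face3` is exceptional. -/
theorem face3_exceptional :
    weilSpaceProd C4xC2 2 (Equiv.refl (Fin (2 * 2))) ⊓
      divisorPowerIn (fun g : C4xC2 => prodTypeSet fun i => g • (face3).face cc_C4xC2_ns i) 2 = ⊥ :=
  (face3).exceptional cc_C4xC2_ns_isComplexConj face3_ok (by decide)

end Faces8C4C2Nonsquare


/-! ### Degree 8: triquadratic `C₂³` — 6 sealed faces -/

namespace Faces8Triquadratic

/-- Faces8Triquadratic: the sealed face `face0` is exceptional. -/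
theorem face0_exceptional :
    weilSpaceProd C2xC2xC2 2 (Equiv.refl (Fin (2 * 2))) ⊓
      divisorPowerIn (fun g : C2xC2xC2 => prodTypeSet fun i => g • (face0).face cc_C2xC2xC2 i) 2 = ⊥ :=
  (face0).exceptional cc_C2xC2xC2_isComplexConj face0_ok (by decide)

/-- Faces8Triquadratic: the sealed face `face1` is exceptional. -/
theorem face1_exceptional :
    weilSpaceProd C2xC2xC2 2 (Equiv.refl (Fin (2 * 2))) ⊓
      divisorPowerIn (fun g : C2xC2xC2 => prodTypeSet fun i => g • (face1).face cc_C2xC2xC2 i) 2 = ⊥ :=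
  (face1).exceptional cc_C2xC2xC2_isComplexConj face1_ok (by decide)

/-- Faces8Triquadratic: the sealed face `face2` is exceptional. -/
theorem face2_exceptional :
    weilSpaceProd C2xC2xC2 2 (Equiv.refl (Fin (2 * 2))) ⊓
      divisorPowerIn (fun g : C2xC2xC2 => prodTypeSet fun i => g • (face2).face cc_C2xC2xC2 i) 2 = ⊥ :=
  (face2).exceptional cc_C2xC2xC2_isComplexConj face2_ok (by decide)

/-- Faces8Triquadratic: the sealed face `face3` is exceptional. -/
theorem face3_exceptional :
    weilSpaceProd C2xC2xC2 2 (Equiv.refl (Fin (2 * 2))) ⊓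
      divisorPowerIn (fun g : C2xC2xC2 => prodTypeSet fun i => g • (face3).face cc_C2xC2xC2 i) 2 = ⊥ :=
  (face3).exceptional cc_C2xC2xC2_isComplexConj face3_ok (by decide)

/-- Faces8Triquadratic: the sealed face `face4` is exceptional. -/
theorem face4_exceptional :
    weilSpaceProd C2xC2xC2 2 (Equiv.refl (Fin (2 * 2))) ⊓
      divisorPowerIn (fun g : C2xC2xC2 => prodTypeSet fun i => g • (face4).face cc_C2xC2xC2 i) 2 = ⊥ :=
  (face4).exceptional cc_C2xC2xC2_isComplexConj face4_ok (by decide)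

/-- Faces8Triquadratic: the sealed face `face5` is exceptional. -/
theorem face5_exceptional :
    weilSpaceProd C2xC2xC2 2 (Equiv.refl (Fin (2 * 2))) ⊓
      divisorPowerIn (fun g : C2xC2xC2 => prodTypeSet fun i => g • (face5).face cc_C2xC2xC2 i) 2 = ⊥ :=
  (face5).exceptional cc_C2xC2xC2_isComplexConj face5_ok (by decide)

end Faces8Triquadratic


/-! ### Degree 8: dihedral `D₄` — 5 sealed faces -/

namespace Faces8Dihedral

/-- Faces8Dihedral: the sealed face `face0` is exceptional. -/
theorem face0_exceptional :
    weilSpaceProd D4 2 (Equiv.refl (Fin (2 * 2))) ⊓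
      divisorPowerIn (fun g : D4 => prodTypeSet fun i => g • (face0).face cc_D4 i) 2 = ⊥ :=
  (face0).exceptional cc_D4_isComplexConj face0_ok (by decide)

/-- Faces8Dihedral: the sealed face `face1` is exceptional. -/
theorem face1_exceptional :
    weilSpaceProd D4 2 (Equiv.refl (Fin (2 * 2))) ⊓
      divisorPowerIn (fun g : D4 => prodTypeSet fun i => g • (face1).face cc_D4 i) 2 = ⊥ :=
  (face1).exceptional cc_D4_isComplexConj face1_ok (by decide)

/-- Faces8Dihedral: the sealed face `face2` is exceptional. -/
theorem face2_exceptional :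
    weilSpaceProd D4 2 (Equiv.refl (Fin (2 * 2))) ⊓
      divisorPowerIn (fun g : D4 => prodTypeSet fun i => g • (face2).face cc_D4 i) 2 = ⊥ :=
  (face2).exceptional cc_D4_isComplexConj face2_ok (by decide)

/-- Faces8Dihedral: the sealed face `face3` is exceptional. -/
theorem face3_exceptional :
    weilSpaceProd D4 2 (Equiv.refl (Fin (2 * 2))) ⊓
      divisorPowerIn (fun g : D4 => prodTypeSet fun i => g • (face3).face cc_D4 i) 2 = ⊥ :=
  (face3).exceptional cc_D4_isComplexConj face3_ok (by decide)

/-- Faces8Dihedral: the sealed face `face4` is exceptional. -/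
theorem face4_exceptional :
    weilSpaceProd D4 2 (Equiv.refl (Fin (2 * 2))) ⊓
      divisorPowerIn (fun g : D4 => prodTypeSet fun i => g • (face4).face cc_D4 i) 2 = ⊥ :=
  (face4).exceptional cc_D4_isComplexConj face4_ok (by decide)

end Faces8Dihedral


/-! ### Degree 8: quaternion `Q₈` — 3 sealed faces -/

namespace Faces8Quaternion

/-- Faces8Quaternion: the sealed face `face0` is exceptional. -/
theorem face0_exceptional :
    weilSpaceProd Q8 2 (Equiv.refl (Fin (2 * 2))) ⊓
      divisorPowerIn (fun g : Q8 => prodTypeSet fun i => g • (face0).face cc_Q8 i) 2 = ⊥ :=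
  (face0).exceptional cc_Q8_isComplexConj face0_ok (by decide)

/-- Faces8Quaternion: the sealed face `face1` is exceptional. -/
theorem face1_exceptional :
    weilSpaceProd Q8 2 (Equiv.refl (Fin (2 * 2))) ⊓
      divisorPowerIn (fun g : Q8 => prodTypeSet fun i => g • (face1).face cc_Q8 i) 2 = ⊥ :=
  (face1).exceptional cc_Q8_isComplexConj face1_ok (by decide)

/-- Faces8Quaternion: the sealed face `face2` is exceptional. -/
theorem face2_exceptional :
    weilSpaceProd Q8 2 (Equiv.refl (Fin (2 * 2))) ⊓
      divisorPowerIn (fun g : Q8 => prodTypeSet fun i => g • (face2).face cc_Q8 i) 2 = ⊥ :=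
  (face2).exceptional cc_Q8_isComplexConj face2_ok (by decide)

end Faces8Quaternion


end HodgeRepro.RouteC
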